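import Summits.ValiantsHypothesis.ValiantsHypothesis.Theorems.KPlusLogSqLawTropicalBToeplitzReduction
import Summits.ValiantsHypothesis.ValiantsHypothesis.Theorems.LacunarySymmetroidMatrixDescartesCensusTropicalKLawBridges

/-!
# Route `KPlusLogSqLaw`, crux `TropicalB` — the Toeplitz sector obeys the `K + log² m` law GIVEN polynomial Conjecture T

HONEST FRAMING.  Helper toward the registered stubs `stub_tropThin` / `stub_tropFat` of
`Cruxes/TropicalB/Lines/birth.lean` (crux `Summit.ValiantsHypothesis.ValiantsHypothesis.Theses.KPlusLogSqLaw.TropicalB`,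
ledger item `stmt-ValiantsHypothesis-19771`, route `KPlusLogSqLaw`; cell `pub-symmetroid`, seat `val-sym-trop-p3`,
2026-08-26).  A CONDITIONAL statement — the payoff of the cell's A-3.5 lane in the crux's own currency: IF the polynomial
form of Conjecture T holds (every linear Toeplitz instance of size `m` has at most `(m+1)^c` pairwise distinct unique optima
along increasing integer slopes, for all admissible sets — the hypothesis of `toeplitz_chain_le_of_linearBound` with
`Φ = (m+1)^c`), THEN every sign-alternating dominant chain of every TOEPLITZ design of format `(m, K)` has
`n ≤ 2^{(9c+13)(K + ⌊log₂ m⌋²)}` — TropicalB's bound on the Toeplitz sector with the constant `9c + 13`.  Conjecture T is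
OPEN (kernel floors `Φ_Toep ≥ 18/23/26/28/26` at `m = 6..10`, `…ToeplitzSix…Ten`; the linear form with constant `3` is
false, `…ToeplitzCalibration`); nothing is claimed about it, about `TropicalB` for general designs, `KPlusLogSqLaw`,
`MatrixDescartes` or `VP ≠ VNP`.

* `toeplitz_sector_kPlusLogSq_of_polyBound` — the conditional law, from `toeplitz_chain_le_of_linearBound` (p429098) and the
  arithmetic `(2(2m+1)K² + 1)(m+1)^c ≤ 2^{(9c+13)(K + ⌊log₂ m⌋²)}` (`pow_le_two_pow_logsq`).

References: `toeplitz_chain_le_of_linearBound` (`…TropicalBToeplitzReduction`, val-sym-trop-p2); `pow_le_two_pow_logsq`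
(`…CensusTropicalKLawBridges`); folklore arithmetic.
-/

set_option linter.dupNamespace false
set_option autoImplicit false

namespace Summit.ValiantsHypothesis.ValiantsHypothesis.Theorems.KPlusLogSqLaw

open Summit.ValiantsHypothesis.ValiantsHypothesis.Theorems.MatrixDescartes.Negative
open Summit.ValiantsHypothesis.ValiantsHypothesis.Theorems.LacunarySymmetroidMatrixDescartes.TropicalCensus
open scoped BigOperators
open Finset

section SectorLaw

/-- arithmetic: `(2(2m+1)K² + 1)(m+1)^c ≤ 2^{(9c+13)(K + ⌊log₂ m⌋²)}` for `K ≥ 1`. [folklore] -/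
theorem toeplitz_sector_arith (c m K : ℕ) (hK : 1 ≤ K) :
    (2 * ((2 * m + 1) * K * K) + 1) * (m + 1) ^ c ≤ 2 ^ ((9 * c + 13) * (K + Nat.log 2 m ^ 2)) := by
  set L := Nat.log 2 m with hL
  -- `m + 1 ≤ 2^(L+1)`
  have hm : m + 1 ≤ 2 ^ (L + 1) := Nat.lt_pow_succ_log_self one_lt_two m
  -- `K ≤ 2^K`, hence `K * K ≤ 2^(2K)`
  have hK2 : K ≤ 2 ^ K := Nat.lt_two_pow_self.le
  have hKK : K * K ≤ 2 ^ (2 * K) := by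
    calc K * K ≤ 2 ^ K * 2 ^ K := Nat.mul_le_mul hK2 hK2
      _ = 2 ^ (2 * K) := by rw [← pow_add]; ring_nf
  -- first factor: `2(2m+1)K² + 1 ≤ 4(m+1)·K² + 1 ≤ 2^(L+3) * 2^(2K) + 1 ≤ 2^(L + 2K + 4)`
  have h1 : 2 * ((2 * m + 1) * K * K) + 1 ≤ 2 ^ (L + 2 * K + 4) := by
    have e1 : 2 * ((2 * m + 1) * K * K) ≤ 4 * (m + 1) * (K * K) := by nlinarith
    have e2 : 4 * (m + 1) * (K * K) ≤ 4 * 2 ^ (L + 1) * 2 ^ (2 * K) :=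
      Nat.mul_le_mul (Nat.mul_le_mul_left 4 hm) hKK
    have e3 : 4 * 2 ^ (L + 1) * 2 ^ (2 * K) = 2 ^ (L + 2 * K + 3) := by
      rw [show (4 : ℕ) = 2 ^ 2 by norm_num, ← pow_add, ← pow_add]; ring_nf
    have e4 : 2 ^ (L + 2 * K + 3) + 1 ≤ 2 ^ (L + 2 * K + 4) := by
      have : 1 ≤ 2 ^ (L + 2 * K + 3) := Nat.one_le_two_pow
      calc 2 ^ (L + 2 * K + 3) + 1 ≤ 2 ^ (L + 2 * K + 3) + 2 ^ (L + 2 * K + 3) := by omega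
        _ = 2 ^ (L + 2 * K + 4) := by ring
    omega
  -- second factor: `(m+1)^c ≤ 2^(2c·L'² + c)` with `L' = log₂ (m+1) ≤ L + 1`
  have h2 : (m + 1) ^ c ≤ 2 ^ (2 * c * Nat.log 2 (m + 1) ^ 2 + c) := pow_le_two_pow_logsq (m + 1) c
  have hL' : Nat.log 2 (m + 1) ≤ L + 1 := by
    have : Nat.log 2 (m + 1) < L + 1 + 1 :=
      Nat.log_lt_of_lt_pow (Nat.succ_ne_zero m)
        (calc m + 1 ≤ 2 ^ (L + 1) := hm
          _ < 2 ^ (L + 1 + 1) := Nat.pow_lt_pow_right (by norm_num) (by omega))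
    omega
  have hL'2 : Nat.log 2 (m + 1) ^ 2 ≤ 2 * L ^ 2 + 2 := by
    calc Nat.log 2 (m + 1) ^ 2 ≤ (L + 1) ^ 2 := Nat.pow_le_pow_left hL' 2
      _ ≤ 2 * L ^ 2 + 2 := by nlinarith
  have h2' : (m + 1) ^ c ≤ 2 ^ (4 * c * L ^ 2 + 5 * c) := by
    refine h2.trans (Nat.pow_le_pow_right (by norm_num) ?_)
    calc 2 * c * Nat.log 2 (m + 1) ^ 2 + c ≤ 2 * c * (2 * L ^ 2 + 2) + c := by
          have := Nat.mul_le_mul_left (2 * c) hL'2; omega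
      _ = 4 * c * L ^ 2 + 5 * c := by ring
  -- combine
  calc (2 * ((2 * m + 1) * K * K) + 1) * (m + 1) ^ c
      ≤ 2 ^ (L + 2 * K + 4) * 2 ^ (4 * c * L ^ 2 + 5 * c) := Nat.mul_le_mul h1 h2'
    _ = 2 ^ (L + 2 * K + 4 + (4 * c * L ^ 2 + 5 * c)) := (pow_add _ _ _).symm
    _ ≤ 2 ^ ((9 * c + 13) * (K + L ^ 2)) := by
        apply Nat.pow_le_pow_right (by norm_num)
        have hLL : L ≤ L ^ 2 := by nlinarith
        nlinarith

/-- **The Toeplitz sector obeys the `K + log² m` law, given polynomial Conjecture T.**  Suppose every linear Toeplitz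
instance of every size `m` has at most `(m+1)^c` pairwise distinct permutations that are unique optima (among permutations
with admissible displacements) at strictly increasing integer slopes — the hypothesis of `toeplitz_chain_le_of_linearBound`
with `Φ = (m+1)^c`, for every `m`.  Then every sign-alternating dominant chain of every TOEPLITZ design (`v a b l = f (a − b) l`,
`ε a b l = g (a − b) l`) of format `(m, K)` has `n ≤ 2^{(9c+13)(K + ⌊log₂ m⌋²)}`: the conclusion of `TropicalB` on the
Toeplitz sector, constant `9c + 13`.  CONDITIONAL: Conjecture T is open. [folklore] -/
theorem toeplitz_sector_kPlusLogSq_of_polyBound (c : ℕ)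
    (hT : ∀ (m : ℕ) (ψ α : ℤ → ℤ) (P : ℤ → Prop) (N : ℕ) (θ' : Fin (N + 1) → ℤ) (τ : Fin (N + 1) → Equiv.Perm (Fin m)),
      StrictMono θ' → Function.Injective τ → (∀ k b, P ((τ k b : ℤ) - (b : ℤ))) →
      (∀ k (σ' : Equiv.Perm (Fin m)), σ' ≠ τ k → (∀ b, P ((σ' b : ℤ) - (b : ℤ))) →
        ∑ b, (θ' k * ψ ((σ' b : ℤ) - (b : ℤ)) + α ((σ' b : ℤ) - (b : ℤ))) <
          ∑ b, (θ' k * ψ ((τ k b : ℤ) - (b : ℤ)) + α ((τ k b : ℤ) - (b : ℤ)))) →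
      N + 1 ≤ (m + 1) ^ c)
    {m K : ℕ} (d : Fin K → ℕ) (f g : ℤ → Fin K → ℤ) (n : ℕ) (θ : Fin (n + 1) → ℤ)
    (p : Fin (n + 1) → Equiv.Perm (Fin m) × (Fin m → Fin K)) (hθ : StrictMono θ)
    (hdom : ∀ k, IsDominant d (fun a b l => f ((a : ℤ) - b) l) (fun a b l => g ((a : ℤ) - b) l) (θ k) (p k))
    (halt : ∀ k : Fin n, termSign (fun a b l => g ((a : ℤ) - b) l) (p k.castSucc) *
      termSign (fun a b l => g ((a : ℤ) - b) l) (p k.succ) < 0) :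
    n ≤ 2 ^ ((9 * c + 13) * (K + Nat.log 2 m ^ 2)) := by
  have hred := toeplitz_chain_le_of_linearBound (m := m) (K := K) ((m + 1) ^ c) (hT m) d f g n θ p hθ hdom halt
  rcases Nat.eq_zero_or_pos K with hK | hK
  · -- no classes: with `m > 0` there are no terms at all, with `m = 0` all terms coincide; either way `n = 0`
    subst hK
    rcases Nat.eq_zero_or_pos n with hn | hn
    · rw [hn]; exact Nat.zero_le _
    · exfalso
      rcases Nat.eq_zero_or_pos m with hm | hm
      · subst hm
        have h := halt ⟨0, hn⟩
        have heq : p (⟨0, hn⟩ : Fin n).castSucc = p (⟨0, hn⟩ : Fin n).succ :=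
          Prod.ext (Equiv.ext fun x => Fin.elim0 x) (funext fun x => Fin.elim0 x)
        rw [heq] at h
        exact absurd h (not_lt.mpr (mul_self_nonneg _))
      · exact Fin.elim0 ((p 0).2 ⟨0, hm⟩)
  · calc n ≤ n + 1 := Nat.le_succ n
      _ ≤ (2 * ((2 * m + 1) * K * K) + 1) * (m + 1) ^ c := hred
      _ ≤ 2 ^ ((9 * c + 13) * (K + Nat.log 2 m ^ 2)) := toeplitz_sector_arith c m K hK

end SectorLaw

end Summit.ValiantsHypothesis.ValiantsHypothesis.Theorems.KPlusLogSqLaw
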